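import Summits.Ventures.PercRepro.LemmaC9
import Summits.Ventures.PercRepro.LemmaCTwoEdgesA

/-!
# Lemma C for every class with at most two varying edges — the configurations and the theorem

Continuation of `LemmaCTwoEdgesA.lean` (split for the ≤ 400-line lint; proofs byte-identical): the sections
«Gladkov constraints», «The four configurations of a two-edge class», «One varying edge and no varying edge»,
«The theorem» (`lemmaC_of_card_le_two`).
-/

namespace PercRepro

open Finset

/-! ### Gladkov constraints on the cells of comparable configurations -/

section Gladkov

variable {E : Type*} [Fintype E] [DecidableEq E] {m : ℕ} {cell : Fin (m + 2) → Set (Config E)}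

omit [Fintype E] [DecidableEq E] in
/-- `A ∪ C_i` is an up-set: membership transfers upwards. -/
theorem mem_union_of_le (hs : GladkovSetting cell) (i : Fin m) {ω ω' : Config E} (h : ω ≤ ω')
    (hω : ω ∈ cell 0 ∪ cell i.succ.succ) : ω' ∈ cell 0 ∪ cell i.succ.succ :=
  hs.upper i h hω

omit [Fintype E] [DecidableEq E] in
/-- A crossing cell moves only to itself or to `A`. -/
theorem cellOf_cross_mono (hs : GladkovSetting cell) {ω ω' : Config E} (h : ω ≤ ω') (hk : 2 ≤ (cellOf hs ω).val) :
    cellOf hs ω' = 0 ∨ cellOf hs ω' = cellOf hs ω := by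
  set k := cellOf hs ω with hkdef
  have hlt := k.isLt
  let i : Fin m := ⟨k.val - 2, by omega⟩
  have hki : k = i.succ.succ := by
    rw [Fin.ext_iff]
    simp only [Fin.val_succ, i]
    omega
  have hω : ω ∈ cell 0 ∪ cell i.succ.succ := by
    right
    rw [← hki]
    exact mem_cell_cellOf hs ω
  have hω' := mem_union_of_le hs i h hω
  rcases hω' with h0 | hi
  · exact Or.inl ((cellOf_eq_iff hs).2 h0)
  · right
    rw [hki]
    exact (cellOf_eq_iff hs).2 hi

omit [Fintype E] [DecidableEq E] in
/-- For `m ≥ 2`, `A` is an up-set. -/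
theorem cellOf_top_mono (hs : GladkovSetting cell) (hm : 2 ≤ m) {ω ω' : Config E} (h : ω ≤ ω') (h0 : cellOf hs ω = 0) :
    cellOf hs ω' = 0 := by
  have hω0 : ω ∈ cell 0 := (cellOf_eq_iff hs).1 h0
  by_contra hne
  set k := cellOf hs ω' with hkdef
  have hk : ω' ∈ cell k := mem_cell_cellOf hs ω'
  -- pick a crossing index `i` with `i.succ.succ ≠ k`
  have hpick : ∃ i : Fin m, i.succ.succ ≠ k := by
    by_cases hk2 : k = (⟨0, by omega⟩ : Fin m).succ.succ
    · refine ⟨⟨1, by omega⟩, ?_⟩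
      rw [hk2]
      intro e
      rw [Fin.ext_iff] at e
      simp at e
    · exact ⟨⟨0, by omega⟩, fun e => hk2 e.symm⟩
  obtain ⟨i, hi⟩ := hpick
  have hω' := mem_union_of_le hs i h (Or.inl hω0)
  rcases hω' with h0' | hi'
  · exact hne ((cellOf_eq_iff hs).2 h0')
  · exact hi ((cellOf_eq_iff hs).2 hi').symm

omit [Fintype E] [DecidableEq E] in
/-- For `m ≥ 1`, `B` is a down-set. -/
theorem cellOf_bot_anti (hs : GladkovSetting cell) (hm : 1 ≤ m) {ω ω' : Config E} (h : ω ≤ ω') (h1 : cellOf hs ω' = 1) :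
    cellOf hs ω = 1 := by
  have hω'1 : ω' ∈ cell 1 := (cellOf_eq_iff hs).1 h1
  by_contra hne
  set k := cellOf hs ω with hkdef
  have hk : ω ∈ cell k := mem_cell_cellOf hs ω
  have hk1 : k ≠ 1 := hne
  -- `ω ∈ A ∪ C_i` for `i = 0` (if `k = 0`) or for the `i` with `k = i.succ.succ`
  have hcases : ∃ i : Fin m, ω ∈ cell 0 ∪ cell i.succ.succ := by
    by_cases hk0 : k = 0
    · exact ⟨⟨0, by omega⟩, Or.inl (hk0 ▸ hk)⟩
    · have hlt := k.isLt
      have h2 : 2 ≤ k.val := by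
        rcases Nat.lt_or_ge k.val 2 with hl | hg
        · exfalso
          rcases Nat.lt_or_ge k.val 1 with hl1 | hg1
          · exact hk0 (Fin.ext (by simp only [Fin.val_zero]; omega))
          · exact hk1 (Fin.ext (by rw [Fin.val_one]; omega))
        · exact hg
      refine ⟨⟨k.val - 2, by omega⟩, Or.inr ?_⟩
      have hki : k = (⟨k.val - 2, by omega⟩ : Fin m).succ.succ := by
        rw [Fin.ext_iff]
        simp only [Fin.val_succ]
        omega
      rw [← hki]
      exact hk
  obtain ⟨i, hi⟩ := hcases
  have hω' := mem_union_of_le hs i h hi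
  rcases hω' with h0' | hi'
  · exact Set.disjoint_left.1 (hs.disjoint (show (1 : Fin (m + 2)) ≠ 0 from one_ne_zero)) hω'1 h0'
  · have hne2 : (1 : Fin (m + 2)) ≠ i.succ.succ := by
      intro e
      rw [Fin.ext_iff] at e
      simp at e
    exact Set.disjoint_left.1 (hs.disjoint hne2) hω'1 hi'

end Gladkov

/-! ### The four configurations of a two-edge class and their cells -/

section TwoEdges

variable {E : Type*} [Fintype E] [DecidableEq E]

/-- `v` with the edge `a` added if `pa` and the edge `b` added if `pb`. -/
def cfg (v : Config E) (a b : E) (pa pb : Bool) : Config E :=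
  fun x => v x || (decide (x = a) && pa) || (decide (x = b) && pb)

omit [Fintype E] in
/-- The two-edge configuration is monotone in the two bits. -/
theorem cfg_mono (v : Config E) (a b : E) {pa pb pa' pb' : Bool} (ha : pa ≤ pa') (hb : pb ≤ pb') :
    cfg v a b pa pb ≤ cfg v a b pa' pb' := by
  intro x
  rw [Bool.le_iff_imp]
  intro h
  have ha' : pa = true → pa' = true := Bool.le_iff_imp.1 ha
  have hb' : pb = true → pb' = true := Bool.le_iff_imp.1 hb
  simp only [cfg, Bool.or_eq_true, Bool.and_eq_true] at h ⊢
  rcases h with (h | ⟨h1, h2⟩) | ⟨h1, h2⟩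
  · exact Or.inl (Or.inl h)
  · exact Or.inl (Or.inr ⟨h1, ha' h2⟩)
  · exact Or.inr ⟨h1, hb' h2⟩

/-- The first bit of an index. -/
def bit0 (p : Fin 4) : Bool := decide (p = 1 ∨ p = 3)

/-- The second bit of an index. -/
def bit1 (p : Fin 4) : Bool := decide (p = 2 ∨ p = 3)

/-- The first bit of the configuration index. -/
theorem bit0_cfgIdx (pa pb : Bool) : bit0 (cfgIdx pa pb) = pa := by cases pa <;> cases pb <;> decide

/-- The second bit of the configuration index. -/
theorem bit1_cfgIdx (pa pb : Bool) : bit1 (cfgIdx pa pb) = pb := by cases pa <;> cases pb <;> decide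

/-- The cells of the four configurations `v, v∪a, v∪b, v∪a∪b`. -/
noncomputable def cells4 {m : ℕ} {cell : Fin (m + 2) → Set (Config E)} (hs : GladkovSetting cell)
    (v : Config E) (a b : E) (p : Fin 4) : Fin (m + 2) :=
  cellOf hs (cfg v a b (bit0 p) (bit1 p))

omit [Fintype E] in
/-- The Gladkov constraints hold for the four cells when `m ≥ 2`. -/
theorem constr_cells4 {m : ℕ} {cell : Fin (m + 2) → Set (Config E)} (hs : GladkovSetting cell)
    (hm : 2 ≤ m) (v : Config E) (a b : E) : Constr m (cells4 hs v a b) := by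
  intro p q hpq
  have hle : cfg v a b (bit0 p) (bit1 p) ≤ cfg v a b (bit0 q) (bit1 q) := by
    rcases hpq with rfl | rfl | rfl
    · exact cfg_mono v a b (by simp [bit0]) (by simp [bit1])
    · exact cfg_mono v a b (by simp [bit0]) (by simp [bit1])
    · exact le_rfl
  refine ⟨fun h0 => cellOf_top_mono hs hm hle h0, fun h1 => cellOf_bot_anti hs (by omega) hle h1,
    fun h2 => cellOf_cross_mono hs hle h2⟩

/-- The colourings of a two-element edge set are pairs of colours. -/
def colourEquiv {a b : E} (hab : a ≠ b) : (↥({a, b} : Finset E) → Fin 3) ≃ Fin 3 × Fin 3 where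
  toFun φ := (φ ⟨a, by simp⟩, φ ⟨b, by simp⟩)
  invFun p := fun x => if (x : E) = a then p.1 else p.2
  left_inv φ := by
    funext ⟨x, hx⟩
    rcases Finset.mem_insert.1 hx with rfl | hx'
    · simp
    · rw [Finset.mem_singleton] at hx'
      subst hx'
      simp [hab.symm]
  right_inv p := by
    ext
    · simp
    · simp [hab.symm]

omit [Fintype E] in
/-- A copy of the triple encoded by the pair of colours `(i, j)` is one of the four
configurations. -/
theorem tripleCopy_eq_cfg (v m' : Config E) {a b : E} (hab : a ≠ b) (i j : Fin 3) (k : Fin 3) :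
    tripleCopy v m' {a, b} ((colourEquiv hab).symm (i, j)) k =
      cfg v a b (gets (m' a) i k) (gets (m' b) j k) := by
  funext x
  simp only [tripleCopy, cfg, colourEquiv, Equiv.coe_fn_symm_mk, gets]
  by_cases hxa : x = a
  · subst hxa
    simp [hab]
  · by_cases hxb : x = b
    · subst hxb
      simp [hab.symm]
    · simp [hxa, hxb]

omit [Fintype E] in
/-- The colouring sum of a two-edge class is the nine-term sum. -/
theorem sum_colourings_two {m : ℕ} {cell : Fin (m + 2) → Set (Config E)} (hs : GladkovSetting cell)
    (v m' : Config E) {a b : E} (hab : a ≠ b) :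
    ∑ φ : ↥({a, b} : Finset E) → Fin 3,
        kerC009 m (cellOf hs (tripleCopy v m' {a, b} φ 0)) (cellOf hs (tripleCopy v m' {a, b} φ 1))
          (cellOf hs (tripleCopy v m' {a, b} φ 2)) =
      (classSum2Z m (m' a) (m' b) (cells4 hs v a b) : ℝ) := by
  rw [← (colourEquiv hab).symm.sum_comp]
  simp only [Fintype.sum_prod_type, Fin.sum_univ_three, tripleCopy_eq_cfg v m' hab, kerC009_eq_kerZ,
    classSum2Z, cells4, bit0_cfgIdx, bit1_cfgIdx]
  push_cast
  ring

end TwoEdges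

/-! ### One varying edge and no varying edge -/

section Small

variable {E : Type*} [Fintype E] [DecidableEq E]

/-- The three positions of the odd copy: `K(s,t,t) + K(t,s,t) + K(t,t,s) ≥ 0` pointwise. -/
theorem kerZ_three_positions {m : ℕ} (s t : Fin (m + 2)) :
    0 ≤ kerZ m s t t + kerZ m t s t + kerZ m t t s := by
  unfold kerZ
  have h1 : ¬ (s < t ∧ t < t) := fun h => lt_irrefl _ h.2
  have h2 : ¬ (t < s ∧ s < t) := fun h => lt_asymm h.1 h.2
  have h3 : ¬ (t < t ∧ t < s) := fun h => lt_irrefl _ h.1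
  simp only [h1, h2, h3, if_false, sub_zero]
  split_ifs <;> norm_num

/-- `v` with the edge `a` added if `pa`. -/
def cfg1 (v : Config E) (a : E) (pa : Bool) : Config E := fun x => v x || (decide (x = a) && pa)

/-- The colourings of a one-element edge set are single colours. -/
def colourEquiv1 (a : E) : (↥({a} : Finset E) → Fin 3) ≃ Fin 3 where
  toFun φ := φ ⟨a, by simp⟩
  invFun i := fun _ => i
  left_inv φ := by
    funext ⟨x, hx⟩
    rw [Finset.mem_singleton] at hx
    subst hx
    rfl
  right_inv i := rfl

omit [Fintype E] in
/-- A copy of the triple encoded by the colour `i` on a single edge. -/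
theorem tripleCopy_eq_cfg1 (v m' : Config E) (a : E) (i k : Fin 3) :
    tripleCopy v m' {a} ((colourEquiv1 a).symm i) k = cfg1 v a (gets (m' a) i k) := by
  funext x
  simp only [tripleCopy, cfg1, colourEquiv1, Equiv.coe_fn_symm_mk, gets]
  by_cases hxa : x = a
  · subst hxa
    cases m' x <;> by_cases hik : i = k <;> simp [hik]
  · simp [hxa]

omit [Fintype E] in
/-- The colouring sum of a one-edge class is nonnegative. -/
theorem sum_colourings_one_nonneg {m : ℕ} {cell : Fin (m + 2) → Set (Config E)}
    (hs : GladkovSetting cell) (v m' : Config E) (a : E) :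
    0 ≤ ∑ φ : ↥({a} : Finset E) → Fin 3,
        kerC009 m (cellOf hs (tripleCopy v m' {a} φ 0)) (cellOf hs (tripleCopy v m' {a} φ 1))
          (cellOf hs (tripleCopy v m' {a} φ 2)) := by
  rw [← (colourEquiv1 a).symm.sum_comp]
  simp only [Fin.sum_univ_three, tripleCopy_eq_cfg1, kerC009_eq_kerZ]
  cases hd : m' a
  · simp only [gets]
    simp
    have := kerZ_three_positions (cellOf hs (cfg1 v a true)) (cellOf hs (cfg1 v a false))
    exact_mod_cast this
  · simp only [gets]
    simp
    have := kerZ_three_positions (cellOf hs (cfg1 v a false)) (cellOf hs (cfg1 v a true))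
    exact_mod_cast this

omit [Fintype E] in
/-- With no varying edge every copy is `v`. -/
theorem tripleCopy_empty (v m' : Config E) (φ : ↥(∅ : Finset E) → Fin 3) (k : Fin 3) :
    tripleCopy v m' ∅ φ k = v := by
  funext x
  simp [tripleCopy]

/-- The kernel vanishes on the diagonal. -/
theorem kerC009_diag {m : ℕ} (c : Fin (m + 2)) : kerC009 m c c c = 0 := by
  unfold kerC009
  have h : ¬ (c < c ∧ c < c) := fun h => lt_irrefl _ h.1
  simp only [h, if_false, sub_zero]
  split_ifs with h0 h1
  · exfalso
    rw [h0] at h1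
    exact absurd h1 (by simp)
  · rfl
  · rfl

omit [Fintype E] in
/-- The colouring sum of a class without varying edges is `0`. -/
theorem sum_colourings_zero {m : ℕ} {cell : Fin (m + 2) → Set (Config E)}
    (hs : GladkovSetting cell) (v m' : Config E) :
    ∑ φ : ↥(∅ : Finset E) → Fin 3,
        kerC009 m (cellOf hs (tripleCopy v m' ∅ φ 0)) (cellOf hs (tripleCopy v m' ∅ φ 1))
          (cellOf hs (tripleCopy v m' ∅ φ 2)) = 0 := by
  simp only [tripleCopy_empty, kerC009_diag, Finset.sum_const_zero]

end Small

/-! ### The theorem -/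

/-- **The abstract Lemma C holds for classes with at most two varying edges**: in every Gladkov
setting and for every triple `(u, m', v)` with `|u ∖ v| ≤ 2`, the colourings of the class weighted
by the kernel sum to a nonnegative number. -/
theorem lemmaC_of_card_le_two {E : Type*} [Fintype E] [DecidableEq E] {m : ℕ}
    {cell : Fin (m + 2) → Set (Config E)} (hs : GladkovSetting cell) (u m' v : Config E)
    (hcard : (openEdges u \ openEdges v).card ≤ 2) :
    0 ≤ ∑ φ : ↥(openEdges u \ openEdges v) → Fin 3,
        kerC009 m (cellOf hs (tripleCopy v m' (openEdges u \ openEdges v) φ 0))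
          (cellOf hs (tripleCopy v m' (openEdges u \ openEdges v) φ 1))
          (cellOf hs (tripleCopy v m' (openEdges u \ openEdges v) φ 2)) := by
  rcases Nat.lt_or_ge m 2 with hm | hm
  · exact Finset.sum_nonneg fun φ _ => kerC009_nonneg_of_le_one (by omega) _ _ _
  generalize hD : openEdges u \ openEdges v = D at hcard ⊢
  rcases Nat.lt_or_ge D.card 2 with h2 | h2
  · rcases Nat.lt_or_ge D.card 1 with h1 | h1
    · have hD0 : D = ∅ := Finset.card_eq_zero.1 (show D.card = 0 by omega)
      subst hD0
      rw [sum_colourings_zero hs v m']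
    · obtain ⟨a, rfl⟩ := Finset.card_eq_one.1 (show D.card = 1 by omega)
      exact sum_colourings_one_nonneg hs v m' a
  · obtain ⟨a, b, hab, rfl⟩ := Finset.card_eq_two.1 (show D.card = 2 by omega)
    rw [sum_colourings_two hs v m' hab]
    exact_mod_cast classSum2Z_nonneg (cells4 hs v a b) (m' a) (m' b) (constr_cells4 hs hm v a b)

end PercRepro
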